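import Literature.NumberTheory.Automorphic.MeyerDifferenceRepresentation
import HarnessLib

/-!
# Meyer's global difference representation — proofs, II: `JΣ𝔉 = Σ + Sing` (Poisson summation)

Topic `NumberTheory/Automorphic`; namespace `Literature.NumberTheory.Automorphic.Meyer`. Sibling
PROOF file of `MeyerDifferenceRepresentation`. For a number field `K`, a Haar measure `μ` on `𝔸_K`
with Meyer's self-dual normalisation `μ(𝔸_K/K) = 1` (`μ (adeleFundamentalDomain K) = 1`) and
`f ∈ 𝒮(𝔸_K)` (`Meyer.schwartzBruhatAdele`), we prove Meyer's form of the Poisson summation formula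
[Meyer2005, §5.4, (5.4)]:

* `Meyer.tsum_eq_tsum_adeleFourier` — `∑_{ξ ∈ K} f(ξ) = ∑_{ξ ∈ K} 𝔉f(ξ)`;
* `Meyer.add_ideleSum_eq` — `f(0) + Σf(x) = |x|⁻¹ (𝔉f(0) + Σ(𝔉f)(x⁻¹))` for every idele `x`
  ("`∑_{a ∈ K} f(ax) = |x|⁻¹ ∑_{a ∈ K} 𝔉f(a x⁻¹)`", [Meyer2005, §5.4 L30–33]);
* **`Meyer.invJ_meyerSum_adeleFourier`** — `J Σ 𝔉 f = Σ f + Sing f` on `C_K` with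
  `Sing f (x) = f(0) - |x|⁻¹ 𝔉f(0)` [Meyer2005, (5.4)], and its consequence
  `Meyer.iPlus_eq_iMinus_of_singular_zero`: if `f(0) = 0 = 𝔉f(0)` then `i₊ f = i₋ (Σ f)`, i.e.
  `i₊ f` lies on the diagonal — the mechanism producing `H₊ ∩ H₋` [Meyer2005, Lemma 5.5].

On the way: the dictionary between Meyer's one-variable objects and the tree's `𝒮(𝔸_K^{Fin 1})`
(`adeleFourier_eq_adelicPiFourier`, `adeleFourier_mem_schwartzBruhatAdele` — **`𝒮(𝔸_K)` is
Fourier-stable**, `summable_norm_algebraMap_of_mem`, `adeleFourier_comp_mul` — `𝔉(f(x·))(ξ) =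
|x|⁻¹ 𝔉f(x⁻¹ξ)`), all deduced from `AdelicPiSchwartzBruhatFourier` / `AdelicRowVectorTwist`.

Everything is proved; no definitions, no named facts. Part of the proof plan for
`Meyer.piPlus_two_dimensional` and `Meyer.spectralRealisation_rat` (Step B).

## References

* R. Meyer, *On a representation of the idele class group related to primes and zeros of
  L-functions*, Duke Math. J. 127 (2005) = arXiv:math/0311468, §5.4, eq. (5.4), Lemma 5.5
  [Meyer2005].
* J. Tate, in Cassels–Fröhlich (eds.), *Algebraic Number Theory* (1967), Ch. XV, Lemma 4.2.4,
  Thm. 4.2.1 [CasselsFrohlichANT1967].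
-/

noncomputable section

open MeasureTheory MeasureTheory.Measure NumberField IsDedekindDomain
open scoped NNReal ENNReal

namespace Literature.NumberTheory.Automorphic.Meyer

section Dictionary

variable {K : Type} [Field K] [NumberField K] [MeasurableSpace (AdeleRing (𝓞 K) K)]

/-- The inverse of `MeasurableEquiv.funUnique (Fin 1) 𝔸_K` is `x ↦ (x)` (definitional).
[folklore] -/
theorem funUnique_symm_apply (x : AdeleRing (𝓞 K) K) (i : Fin 1) :
    (MeasurableEquiv.funUnique (Fin 1) (AdeleRing (𝓞 K) K)).symm x i = x := rfl

omit [MeasurableSpace (AdeleRing (𝓞 K) K)] in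
/-- A vector indexed by `Fin 1` is the constant vector of its entry. [folklore] -/
theorem const_apply_zero_eq (v : Fin 1 → AdeleRing (𝓞 K) K) : (fun _ : Fin 1 => v 0) = v := by
  funext i
  rw [Fin.fin_one_eq_zero i]

/-- **Meyer's `𝔉` is the tree's `adelicPiFourier` in one variable**: for the image measure on
`𝔸_K^{Fin 1}`, `𝔉f(ξ) = (v ↦ f(v 0))^(ξ)`. [folklore] -/
theorem adeleFourier_eq_adelicPiFourier (μ : Measure (AdeleRing (𝓞 K) K))
    (f : AdeleRing (𝓞 K) K → ℂ) (ξ : AdeleRing (𝓞 K) K) :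
    adeleFourier K μ f ξ =
      adelicPiFourier K (Fin 1) (μ.map (MeasurableEquiv.funUnique (Fin 1) (AdeleRing (𝓞 K) K)).symm)
        (fun v => f (v 0)) (fun _ => ξ) := by
  rw [adelicPiFourier_apply, integral_map_equiv]
  unfold adeleFourier
  refine integral_congr_ae (ae_of_all _ fun x => ?_)
  simp only [funUnique_symm_apply, Finset.univ_unique, Fin.default_eq_zero, Finset.sum_singleton,
    mul_comm x ξ]

/-- The same, as an identity of functions on `𝔸_K^{Fin 1}`. [folklore] -/
theorem adeleFourier_comp_eval_eq_adelicPiFourier (μ : Measure (AdeleRing (𝓞 K) K))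
    (f : AdeleRing (𝓞 K) K → ℂ) :
    (fun v : Fin 1 → AdeleRing (𝓞 K) K => adeleFourier K μ f (v 0)) =
      adelicPiFourier K (Fin 1) (μ.map (MeasurableEquiv.funUnique (Fin 1) (AdeleRing (𝓞 K) K)).symm)
        (fun v => f (v 0)) := by
  funext v
  rw [adeleFourier_eq_adelicPiFourier, const_apply_zero_eq]

variable [BorelSpace (AdeleRing (𝓞 K) K)] (μ : Measure (AdeleRing (𝓞 K) K)) [μ.IsAddHaarMeasure]

/-- The image of a Haar measure on `𝔸_K` on `𝔸_K^{Fin 1}` is a Haar measure. [folklore] -/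
theorem isAddHaarMeasure_map_funUnique_symm :
    (μ.map (MeasurableEquiv.funUnique (Fin 1) (AdeleRing (𝓞 K) K)).symm).IsAddHaarMeasure := by
  haveI := secondCountableTopology_adeleRing K
  haveI : BorelSpace (Fin 1 → AdeleRing (𝓞 K) K) := Pi.borelSpace
  let e : AdeleRing (𝓞 K) K ≃+ (Fin 1 → AdeleRing (𝓞 K) K) :=
    { (Equiv.funUnique (Fin 1) (AdeleRing (𝓞 K) K)).symm with map_add' := fun _ _ => rfl }
  have he : Continuous e := continuous_pi fun _ => continuous_id
  have hes : Continuous e.symm := continuous_apply (0 : Fin 1)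
  exact e.isAddHaarMeasure_map μ he hes

/-- **`𝒮(𝔸_K)` is stable under the Fourier transform** `𝔉 = 𝔉_μ` (any Haar measure `μ`), from
`adelicPiFourier_mem_piSchwartzBruhat`. [cite: Meyer2005, §5.1] -/
theorem adeleFourier_mem_schwartzBruhatAdele {f : AdeleRing (𝓞 K) K → ℂ}
    (hf : f ∈ schwartzBruhatAdele K) : adeleFourier K μ f ∈ schwartzBruhatAdele K := by
  haveI := isAddHaarMeasure_map_funUnique_symm μ
  rw [mem_schwartzBruhatAdele_iff, adeleFourier_comp_eval_eq_adelicPiFourier]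
  exact adelicPiFourier_mem_piSchwartzBruhat (mem_schwartzBruhatAdele_iff.mp hf)

omit [MeasurableSpace (AdeleRing (𝓞 K) K)] [BorelSpace (AdeleRing (𝓞 K) K)] in
/-- Rational values of a Bruhat–Schwartz function are absolutely summable: `∑_{ξ ∈ K} |f(ξ)| < ∞`.
[folklore] -/
theorem summable_norm_algebraMap_of_mem {f : AdeleRing (𝓞 K) K → ℂ}
    (hf : f ∈ schwartzBruhatAdele K) :
    Summable fun ξ : K => ‖f (algebraMap K (AdeleRing (𝓞 K) K) ξ)‖ := by
  have h := summable_norm_of_mem_piSchwartzBruhat hf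
  have h2 := (Equiv.funUnique (Fin 1) K).symm.summable_iff.2 h
  exact h2.congr fun ξ => rfl

omit [MeasurableSpace (AdeleRing (𝓞 K) K)] [BorelSpace (AdeleRing (𝓞 K) K)] in
/-- Rational values of a Bruhat–Schwartz function are summable. [folklore] -/
theorem summable_algebraMap_of_mem {f : AdeleRing (𝓞 K) K → ℂ} (hf : f ∈ schwartzBruhatAdele K) :
    Summable fun ξ : K => f (algebraMap K (AdeleRing (𝓞 K) K) ξ) :=
  (summable_norm_algebraMap_of_mem hf).of_norm

/-- **Poisson summation for `𝒮(𝔸_K)` with the self-dual measure**: if `μ(𝔸_K/K) = 1` then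
`∑_{ξ ∈ K} f(ξ) = ∑_{ξ ∈ K} 𝔉f(ξ)`. [cite: Meyer2005, §5.4] -/
theorem tsum_eq_tsum_adeleFourier (hμ : μ (adeleFundamentalDomain K) = 1)
    {f : AdeleRing (𝓞 K) K → ℂ} (hf : f ∈ schwartzBruhatAdele K) :
    ∑' ξ : K, f (algebraMap K (AdeleRing (𝓞 K) K) ξ) =
      ∑' ξ : K, adeleFourier K μ f (algebraMap K (AdeleRing (𝓞 K) K) ξ) := by
  haveI := isAddHaarMeasure_map_funUnique_symm μ
  set ν := μ.map (MeasurableEquiv.funUnique (Fin 1) (AdeleRing (𝓞 K) K)).symm with hν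
  have h := tsum_eq_inv_measure_mul_tsum_adelicPiFourier (K := K) (ι := Fin 1) (ν := ν) hf
  have hD : ν (piFundamentalDomain K (Fin 1)) = 1 := by
    rw [hν, MeasurableEquiv.map_apply]
    have : (MeasurableEquiv.funUnique (Fin 1) (AdeleRing (𝓞 K) K)).symm ⁻¹'
        piFundamentalDomain K (Fin 1) = adeleFundamentalDomain K := by
      ext x
      simp [piFundamentalDomain]
    rw [this, hμ]
  rw [hD, ENNReal.toReal_one, inv_one, Complex.ofReal_one, one_mul] at h
  calc ∑' ξ : K, f (algebraMap K (AdeleRing (𝓞 K) K) ξ)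
      = ∑' ξ : Fin 1 → K, f (algebraMap K (AdeleRing (𝓞 K) K) (ξ 0)) :=
        ((Equiv.funUnique (Fin 1) K).tsum_eq
          (fun ξ : K => f (algebraMap K (AdeleRing (𝓞 K) K) ξ))).symm
    _ = ∑' ξ : Fin 1 → K, adelicPiFourier K (Fin 1) ν (fun v => f (v 0))
          (fun i => algebraMap K (AdeleRing (𝓞 K) K) (ξ i)) := h
    _ = ∑' ξ : Fin 1 → K, adeleFourier K μ f (algebraMap K (AdeleRing (𝓞 K) K) (ξ 0)) := by
        refine tsum_congr fun ξ => ?_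
        rw [adeleFourier_eq_adelicPiFourier]
        congr 1
        funext i
        rw [Fin.fin_one_eq_zero i]
    _ = ∑' ξ : K, adeleFourier K μ f (algebraMap K (AdeleRing (𝓞 K) K) ξ) :=
        (Equiv.funUnique (Fin 1) K).tsum_eq
          (fun ξ : K => adeleFourier K μ f (algebraMap K (AdeleRing (𝓞 K) K) ξ))

/-- **The Fourier transform of a dilate**: for an idele `x`,
`𝔉(f(x ·))(ξ) = |x|⁻¹ · 𝔉f(x⁻¹ ξ)` (Tate's "replace `f(𝔵)` by `f(𝔞𝔵)`", Thm. 4.2.1).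
[cite: CasselsFrohlichANT1967, Ch. XV Thm. 4.2.1] -/
theorem adeleFourier_comp_mul (f : AdeleRing (𝓞 K) K → ℂ) (x : GaloisRepresentations.ideleGroup K)
    (ξ : AdeleRing (𝓞 K) K) :
    adeleFourier K μ (fun y => f ((x : AdeleRing (𝓞 K) K) * y)) ξ =
      ((IdeleClassGroup.ideleNorm K x⁻¹ : ℝ≥0) : ℂ) *
        adeleFourier K μ f (((x⁻¹ : GaloisRepresentations.ideleGroup K) : AdeleRing (𝓞 K) K) * ξ) := by
  haveI := isAddHaarMeasure_map_funUnique_symm μ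
  rw [adeleFourier_eq_adelicPiFourier, adeleFourier_eq_adelicPiFourier]
  have h := adelicPiFourier_comp_smul
    (μ.map (MeasurableEquiv.funUnique (Fin 1) (AdeleRing (𝓞 K) K)).symm)
    (fun v : Fin 1 → AdeleRing (𝓞 K) K => f (v 0)) x (fun _ => ξ)
  have hsmul : (((x⁻¹ : GaloisRepresentations.ideleGroup K) : AdeleRing (𝓞 K) K) •
      fun _ : Fin 1 => ξ) = fun _ => ((x⁻¹ : GaloisRepresentations.ideleGroup K) : AdeleRing (𝓞 K) K) * ξ :=
    rfl
  rw [pow_one, hsmul] at h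
  exact h

end Dictionary

/-! ### `JΣ𝔉 = Σ + Sing` -/

section Poisson

variable {K : Type} [Field K] [NumberField K]
  [MeasurableSpace (AdeleRing (𝓞 K) K)] [BorelSpace (AdeleRing (𝓞 K) K)]
  (μ : Measure (AdeleRing (𝓞 K) K)) [μ.IsAddHaarMeasure]

omit [NumberField K] [MeasurableSpace (AdeleRing (𝓞 K) K)] [BorelSpace (AdeleRing (𝓞 K) K)] in
/-- Splitting a sum over `K` into the term at `0` and the sum over `Kˣ`. [folklore] -/
theorem tsum_eq_zero_add_tsum_units {g : K → ℂ} (hg : Summable g) :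
    ∑' ξ : K, g ξ = g 0 + ∑' a : Kˣ, g (a : K) := by
  classical
  rw [hg.tsum_eq_add_tsum_ite 0]
  congr 1
  have hsupp : Function.support (fun ξ : K => if ξ = 0 then 0 else g ξ) ⊆ Set.range (Units.val : Kˣ → K) := by
    intro ξ hξ
    rw [Function.mem_support] at hξ
    have h0 : ξ ≠ 0 := fun h => hξ (if_pos h)
    exact ⟨Units.mk0 ξ h0, rfl⟩
  rw [← (Units.val_injective (α := K)).tsum_eq hsupp]
  exact tsum_congr fun a => if_neg a.ne_zero

/-- **Poisson summation along an idele** [Meyer2005, §5.4: "`∑_{a∈K} f(ax) = |x|⁻¹ ∑_{a∈K} 𝔉f(ax⁻¹)`"],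
in the form `f(0) + Σf(x) = |x|⁻¹ (𝔉f(0) + Σ(𝔉f)(x⁻¹))` with Meyer's summation map
`Σf(x) = ∑_{a ∈ Kˣ} f(ax)` (`Meyer.ideleSum`), for `f ∈ 𝒮(𝔸_K)` and the self-dual Haar measure.
[cite: Meyer2005, §5.4] -/
theorem add_ideleSum_eq (hμ : μ (adeleFundamentalDomain K) = 1) {f : AdeleRing (𝓞 K) K → ℂ}
    (hf : f ∈ schwartzBruhatAdele K) (x : GaloisRepresentations.ideleGroup K) :
    f 0 + ideleSum K f x =
      ((IdeleClassGroup.ideleNorm K x : ℝ≥0) : ℂ)⁻¹ *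
        (adeleFourier K μ f 0 + ideleSum K (adeleFourier K μ f) x⁻¹) := by
  -- the dilate `g = f(x ·)` is Bruhat–Schwartz
  set g : AdeleRing (𝓞 K) K → ℂ := fun y => f ((x : AdeleRing (𝓞 K) K) * y) with hg
  have hgS : g ∈ schwartzBruhatAdele K := by
    have h := adeleDilation_mem_schwartzBruhatAdele hf x⁻¹
    have hfun : adeleDilation K x⁻¹ f = g := by
      funext y
      rw [adeleDilation_apply, inv_inv]
    rwa [hfun] at h
  have hP := tsum_eq_tsum_adeleFourier μ hμ hgS
  -- left-hand side: split off `ξ = 0`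
  have hL : ∑' ξ : K, g (algebraMap K (AdeleRing (𝓞 K) K) ξ) = f 0 + ideleSum K f x := by
    rw [tsum_eq_zero_add_tsum_units (summable_algebraMap_of_mem hgS)]
    simp only [hg, map_zero, mul_zero, ideleSum]
    congr 1
    exact tsum_congr fun a => by rw [mul_comm]
  -- right-hand side: `𝔉g(ξ) = |x|⁻¹ 𝔉f(x⁻¹ ξ)`
  have hFg : adeleFourier K μ g = fun ξ => ((IdeleClassGroup.ideleNorm K x⁻¹ : ℝ≥0) : ℂ) *
      adeleFourier K μ f (((x⁻¹ : GaloisRepresentations.ideleGroup K) : AdeleRing (𝓞 K) K) * ξ) := by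
    funext ξ
    exact adeleFourier_comp_mul μ f x ξ
  have hFS : adeleFourier K μ f ∈ schwartzBruhatAdele K := adeleFourier_mem_schwartzBruhatAdele μ hf
  have hdil : (fun ξ => adeleFourier K μ f
      (((x⁻¹ : GaloisRepresentations.ideleGroup K) : AdeleRing (𝓞 K) K) * ξ)) ∈ schwartzBruhatAdele K := by
    have h := adeleDilation_mem_schwartzBruhatAdele hFS x
    have hfun : adeleDilation K x (adeleFourier K μ f) = fun ξ => adeleFourier K μ f
        (((x⁻¹ : GaloisRepresentations.ideleGroup K) : AdeleRing (𝓞 K) K) * ξ) := by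
      funext ξ
      rw [adeleDilation_apply]
    rwa [hfun] at h
  have hR : ∑' ξ : K, adeleFourier K μ g (algebraMap K (AdeleRing (𝓞 K) K) ξ) =
      ((IdeleClassGroup.ideleNorm K x⁻¹ : ℝ≥0) : ℂ) *
        (adeleFourier K μ f 0 + ideleSum K (adeleFourier K μ f) x⁻¹) := by
    rw [hFg]
    simp only
    rw [tsum_mul_left, tsum_eq_zero_add_tsum_units (summable_algebraMap_of_mem hdil)]
    simp only [map_zero, mul_zero, ideleSum]
    congr 2
    exact tsum_congr fun a => by rw [mul_comm]
  rw [← hL, hP, hR, map_inv, NNReal.coe_inv, Complex.ofReal_inv]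

/-- **`JΣ𝔉 = Σ + Sing`** [Meyer2005, (5.4)]: for `f ∈ 𝒮(𝔸_K)` and the self-dual Haar measure,
`J(Σ(𝔉f))(x) = Σf(x) + f(0) - |x|⁻¹ 𝔉f(0)` on `C_K`, where `Sing f = f(0) - |x|⁻¹·𝔉f(0)` spans,
with `f`, the two-dimensional space `ℂ·1 + ℂ·|x|⁻¹`. [cite: Meyer2005, §5.4 (5.4)] -/
theorem invJ_meyerSum_adeleFourier (hμ : μ (adeleFundamentalDomain K) = 1)
    {f : AdeleRing (𝓞 K) K → ℂ} (hf : f ∈ schwartzBruhatAdele K) :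
    invJ K (meyerSum K (adeleFourier K μ f)) =
      meyerSum K f + fun c => f 0 - ((classNorm K c : ℝ) : ℂ)⁻¹ * adeleFourier K μ f 0 := by
  funext c
  induction c using QuotientGroup.induction_on with
  | H x =>
    rw [invJ_apply, Pi.add_apply]
    have hinv : ((x : IdeleClassGroup K))⁻¹ = ((x⁻¹ : GaloisRepresentations.ideleGroup K) :
        IdeleClassGroup K) := rfl
    rw [hinv, meyerSum_mk, meyerSum_mk]
    have h := add_ideleSum_eq μ hμ hf x
    have hnorm : ((classNorm K (x : IdeleClassGroup K) : ℝ) : ℂ) =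
        ((IdeleClassGroup.ideleNorm K x : ℝ≥0) : ℂ) := rfl
    rw [hnorm]
    rw [mul_add] at h
    linear_combination -h

/-- **The diagonal elements of `H₊`**: if `f ∈ 𝒮(𝔸_K)` has `f(0) = 0` and `𝔉f(0) = 0`
(`Sing f = 0`), then `JΣ𝔉f = Σf`, i.e. `i₊ f = (Σf, Σf) = i₋(Σf)` [Meyer2005, Lemma 5.5:
`H₊ + H₋ = {(f₀,f₁) | f₀ - f₁ ∈ ℂ - ℂ|x|⁻¹}`]. [cite: Meyer2005, Lemma 5.5] -/
theorem iPlus_eq_iMinus_of_singular_zero (hμ : μ (adeleFundamentalDomain K) = 1)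
    {f : AdeleRing (𝓞 K) K → ℂ} (hf : f ∈ schwartzBruhatAdele K) (h0 : f 0 = 0)
    (hF0 : adeleFourier K μ f 0 = 0) : iPlus K μ f = iMinus K (meyerSum K f) := by
  rw [iPlus, iMinus_apply, invJ_meyerSum_adeleFourier μ hμ hf, h0, hF0]
  ext c <;> simp

/-- The difference of the two components of `i₊ f` is `-Sing f = |x|⁻¹𝔉f(0) - f(0)`, a vector
of `ℂ·1 + ℂ·|x|⁻¹` [Meyer2005, Lemma 5.5]. [cite: Meyer2005, Lemma 5.5] -/
theorem iPlus_fst_sub_snd (hμ : μ (adeleFundamentalDomain K) = 1)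
    {f : AdeleRing (𝓞 K) K → ℂ} (hf : f ∈ schwartzBruhatAdele K) (c : IdeleClassGroup K) :
    (iPlus K μ f).1 c - (iPlus K μ f).2 c =
      ((classNorm K c : ℝ) : ℂ)⁻¹ * adeleFourier K μ f 0 - f 0 := by
  simp only [iPlus, invJ_meyerSum_adeleFourier μ hμ hf, Pi.add_apply]
  ring

end Poisson

end Literature.NumberTheory.Automorphic.Meyer
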